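import Summits.QuantumFields.YangMills.Theorems.FluctuationComparisonRegPrIntLS2BetaExpChartOpen
import Literature.MathematicalPhysics.QuantumFieldTheory.Balaban1983to89.LogChartProduct
import HarnessLib

/-!
# (C3) THE FRAMED HAAR CHART ON THE NAMED WINDOW `e ⁻¹' B(0, s_C∕2)` + THE RADII OF THE PRODUCT CHART

Crux `stmt-QuantumFields-20520` (`…Theses.UnitScaleTilt.FluctuationComparisonRegPrIntL`), LINE g18-1 S2β, organ (C3) ∕ DET-REP (B) (Q-TUBE)(ii); cell `ym3-torus`
(HUMAN RULING D-0037 — YM₃ on T³ is ladder rung R3, not the Clay problem), width seat `ym3-torus-px21` g17; count-neutral helper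
(`--kind proof --supports stmt-QuantumFields-20520 --as helper`).  Theorems only: 0 `def`, 0 `instance`, 0 `notation`, 0 `sorry`.

WHY.  The cover ∕ inner-radius row (Q-TUBE)(ii) of the tubular tree-gauge chart (`…S2BetaTreeGaugeChartLocalCover`, this seat) needs the free-bond window
of ✓`…S2BetaExpChartOpen.exists_haarChart_expChart_frame_open_explicit` BY NAME (`U = e ⁻¹' B(0, s_C∕2)`), not existentially, and the fact that the
product chart `𝔤^B` (lit `piLogChart`) has the radii of the one-bond chart `𝔤` — so that the radius is DEPTH-UNIFORM.
* `innerRadius_piLogChart`, `chartRadius_piLogChart` — `r_{C^B} = r_C`, `s_{C^B} = s_C` (lit `piLogChart_rho`: `min (min ρ ½) ½ = min ρ ½`).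
* ★ `exists_haarChart_expChart_frame_open_ball` — the rows of ✓`exists_haarChart_expChart_frame_open_explicit` ON THE NAMED WINDOW (same proof).
HONEST SCOPE.  Bookkeeping; nothing of Bałaban's analysis; (Q-TUBE), DET-REP (B), S2β, stmt-QuantumFields-20520 NOT proved; rung R3 = YM₃ on T³ —
NOT d = 4, NOT infinite volume, NOT a mass gap, NOT Clay.
[cite: Helgason2000, Ch. I §1 Thm 1.14 (13) p.96; Balaban1985UV3, (18) p.260]
-/

noncomputable section

open MeasureTheory MeasureTheory.Measure Set Function Filter Topology
open scoped ENNReal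
open Literature.MathematicalPhysics.QuantumFieldTheory.Balaban1983to89
open Literature.MathematicalPhysics.QuantumFieldTheory.Balaban1983to89.HaarExponentialChart
open Literature.MathematicalPhysics.QuantumFieldTheory.Balaban1983to89.LogChartProduct
open Literature.MathematicalPhysics.QuantumFieldTheory.Balaban1983to89.B13HaarSigmaJacobian (jac)
open Literature.Analysis.Asymptotics

namespace Summit.QuantumFields.YangMills.Theorems.FluctuationComparisonRegPrIntLS2BetaExpChartOpenBall

open Summit.QuantumFields.YangMills.Theorems.FluctuationComparisonRegPrIntLS2BetaExpChartOpen (expChart_frame_image_mem_nhds)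

/-! ## §1  The radii of the product chart -/

section Radii

variable {𝔸 : Type*} [NormedRing 𝔸] [NormedAlgebra ℂ 𝔸] [CompleteSpace 𝔸] (C : LogChart 𝔸) (B : Type*) [Fintype B]

/-- The product chart `𝔤^B` has the inner radius of `𝔤`: `r_{C^B} = min (min ρ_C ½) ½ = min ρ_C ½ = r_C` (lit `piLogChart_rho`). DEPTH-UNIFORMITY of every
window radius below. [cite: Helgason2000, Ch. I §1 Thm 1.14 (13) p.96] [cite: Balaban1985UV3, (18) p.260] -/
theorem innerRadius_piLogChart : IsChartRep.innerRadius (piLogChart C B) = IsChartRep.innerRadius C := by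
  show min (piLogChart C B).ρ (1 / 2) = min C.ρ (1 / 2)
  rw [piLogChart_rho, min_assoc, min_self]

/-- The product chart `𝔤^B` has the chart radius of `𝔤`: `s_{C^B} = s_C` — so the free-bond window `eV ⁻¹' B(0, s_{C^{β∖F}}∕2)` of the tubular chart has a
radius depending on the one-bond chart `C` ONLY. [cite: Helgason2000, Ch. I §1 Thm 1.14 (13) p.96] [cite: Balaban1985UV3, (18) p.260] -/
theorem chartRadius_piLogChart : IsChartRep.chartRadius (piLogChart C B) = IsChartRep.chartRadius C := by
  simp only [IsChartRep.chartRadius, innerRadius_piLogChart]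

end Radii

/-! ## §2  The framed Haar chart on the named window -/

section FrameBall

variable {𝔸 : Type*} [NormedRing 𝔸] [NormedAlgebra ℂ 𝔸] [CompleteSpace 𝔸]
variable {G : Type*} [Group G] [TopologicalSpace G] [IsTopologicalGroup G] [CompactSpace G]
  [MeasurableSpace G] [BorelSpace G]
variable {C : LogChart 𝔸} {ρ : G →* 𝔸} (h : IsChartRep C ρ) [FiniteDimensional ℝ C.lie]
variable [MeasurableSpace C.lie] [BorelSpace C.lie]
variable {V : Type*} [NormedAddCommGroup V] [InnerProductSpace ℝ V] [FiniteDimensional ℝ V]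
  [MeasurableSpace V] [BorelSpace V]

include h in
/-- ★ **THE FRAMED HAAR CHART, OPEN EDITION, DENSITY EXPLICIT, WINDOW NAMED**: the rows of
✓`…S2BetaExpChartOpen.exists_haarChart_expChart_frame_open_explicit` (injectivity of `v ↦ Θ(e v)`, openness at every point, the window constant
`σ₀ > 0`, the chart identity `μ|_{Θ(e(U))} = (Θ∘e)_*((σ₀ |det jac(e ·)| · dv)|_U)`) stated FOR THE WINDOW `U := e ⁻¹' B(0, s_C∕2)` ITSELF rather than for
some open `U ∋ 0` — same proof as the landed letter (lit `haar_restrict_window_eq_map_withDensity_frame`, `expChart_frame_image_mem_nhds`).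
[cite: Helgason2000, Ch. I §1 Thm 1.14 (13) p. 96] [cite: Balaban1985UV3, p. 260] -/
theorem exists_haarChart_expChart_frame_open_ball
    (hlie : ∀ x ∈ C.lie, ∀ y ∈ C.lie, x * y - y * x ∈ C.lie) (μ : Measure G) [μ.IsHaarMeasure] (e : V ≃L[ℝ] C.lie) :
    ∃ σ₀ : ℝ, IsOpen (e ⁻¹' Metric.ball (0 : C.lie) (IsChartRep.chartRadius C / 2)) ∧
      (0 : V) ∈ e ⁻¹' Metric.ball (0 : C.lie) (IsChartRep.chartRadius C / 2) ∧
      Set.InjOn (fun v => h.expChart (e v)) (e ⁻¹' Metric.ball (0 : C.lie) (IsChartRep.chartRadius C / 2)) ∧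
      (∀ v ∈ e ⁻¹' Metric.ball (0 : C.lie) (IsChartRep.chartRadius C / 2), ∀ N ∈ 𝓝 v,
        (fun v => h.expChart (e v)) '' N ∈ 𝓝 (h.expChart (e v))) ∧
      0 < σ₀ ∧
      μ.restrict ((fun v => h.expChart (e v)) '' (e ⁻¹' Metric.ball (0 : C.lie) (IsChartRep.chartRadius C / 2))) =
        (((volume : Measure V).restrict (e ⁻¹' Metric.ball (0 : C.lie) (IsChartRep.chartRadius C / 2))).withDensity fun v =>
            ENNReal.ofReal (σ₀ * |LinearMap.det (jac hlie (e v) : C.lie →ₗ[ℝ] C.lie)|)).map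
          (fun v => h.expChart (e v)) := by
  haveI : ((volume : Measure V).map e).IsAddHaarMeasure := e.isAddHaarMeasure_map volume
  have hs0 : 0 < IsChartRep.chartRadius C := IsChartRep.chartRadius_pos
  have hs2 : IsChartRep.chartRadius C / 2 ≤ IsChartRep.chartRadius C := by linarith
  have hc := h.windowConst_ne_zero_and_ne_top hlie ((volume : Measure V).map e) μ hs0 le_rfl
  refine ⟨(μ (h.window (IsChartRep.chartRadius C)) /
      h.chartMeasure hlie ((volume : Measure V).map e) (IsChartRep.chartRadius C) (h.window (IsChartRep.chartRadius C))).toReal,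
    Metric.isOpen_ball.preimage e.continuous, ?_, ?_, ?_, ENNReal.toReal_pos hc.1 hc.2, ?_⟩
  · rw [Set.mem_preimage, map_zero]
    exact Metric.mem_ball_self (by linarith)
  · exact (h.injOn_expChart hs2).comp e.injective.injOn fun v hv => hv
  · intro v hv N hN
    have hv' : ‖e v‖ < IsChartRep.chartRadius C := lt_of_lt_of_le (mem_ball_zero_iff.1 hv) hs2
    exact expChart_frame_image_mem_nhds h e hv' hN
  · exact haar_restrict_window_eq_map_withDensity_frame h hlie μ e

end FrameBall

end Summit.QuantumFields.YangMills.Theorems.FluctuationComparisonRegPrIntLS2BetaExpChartOpenBall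

end
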